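import Summits.CriticalPhenomena.PercolationContinuityZ3.Theorems.PercNearOneGluingNoHeavyLowerTailThresholdRABStrict

/-!
# `NoHeavyLowerTail` (crux stmt-CriticalPhenomena-4575), lane prim-ineq-gen-4 (gen 30): the VERTICAL-BIAS LEMMA and the single-coordinate lemma

Support file (`--supports stmt-CriticalPhenomena-4575`; memo `run/shared/lean/prim/prim-ineq-gen-4/FINDING-SLACK-INDUCTION-g30.md` §0(3),(5)).
Pure finite combinatorics, no definitions, no `sorry`, standard axioms.

CONTEXT.  Gen 29 reduced every diagonal anti-band cell `(AB_m)(2m)` to the single-level Harris-type inequality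
`Cov(f,g) ≥ P(#x = m) · Cov(f,g | #x = m)` for increasing `f,g` on `{0,1}^{2m}` (bridge `AntiBandLevelHarrisBridge.antiBand_of_bandHarris`).
Gen 30 found that the sharp form is `Cov(f,g) ≥ 2 · P(#x = m) · Cov(f,g | #x = m)` ((P2), verified for all pairs of up-sets, `n ≤ 6`), with EQUALITY at
`f = x_i` (dictator), `g = 1{#x > m ∨ (#x = m ∧ i ∈ x)}`.  The two rank-one facets of this bilinear inequality through its zero are:
* `g` fixed at the extremal set, `f = 1_A` arbitrary: equivalent to the **vertical-bias lemma** `card_lt_add_card_mid_mem_le` below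
  (`#A_{<m} + #{y ∈ A_m | i ∈ y} ≤ #A_{>m} + #{y ∈ A_m | i ∉ y}`: the vertical imbalance of an up-set dominates its middle-layer bias towards any coordinate);
* `f = x_i` fixed, `g = 1_A` arbitrary: the **single-coordinate lemma** `two_mul_card_mid_mem_le` below
  (`2·#{y ∈ A_m | i ∈ y} ≤ 2·#{y ∈ A_m | i ∉ y} + #{pivotal i-edges of A}`; memo g29 §0(9), here in the kernel).
Both follow from the mirror inequality for lower sets inside a ground finset (`ThresholdRAB.card_level_mirror_le`, local LYM) applied to the two
sections `i ∈ x` / `i ∉ x` of `A`, which live in a ground set of odd size `2m − 1`.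
-/

namespace Summit.CriticalPhenomena.PercolationContinuityZ3.Theorems.AntiBandVerticalBias

open Finset
open scoped FinsetFamily
open Summit.CriticalPhenomena.PercolationContinuityZ3.Theorems.ThresholdRAB (card_level_mirror_le)

variable {α : Type*} [DecidableEq α] [Fintype α]

/-! ### The two sections of an up-set as lower sets inside `univ.erase i` -/

/-- Complements of the members containing `i` of an up-set form a lower set. [folklore] -/
theorem isLowerSet_image_compl (A : Finset (Finset α)) (hA : IsUpperSet (A : Set (Finset α))) (i : α) :
    IsLowerSet (((A.filter fun x => i ∈ x).image compl : Finset (Finset α)) : Set (Finset α)) := by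
  intro v w hwv hv
  rw [mem_coe, mem_image] at hv ⊢
  obtain ⟨x, hx, rfl⟩ := hv
  rw [mem_filter] at hx
  have hxw : x ⊆ wᶜ := by
    intro a ha
    rw [mem_compl]
    intro haw
    exact absurd ha (mem_compl.1 (hwv haw))
  exact ⟨wᶜ, mem_filter.2 ⟨hA hxw hx.1, hxw hx.2⟩, compl_compl w⟩

/-- The members of the complemented `i ∈ x` section avoid `i`. [folklore] -/
theorem image_compl_subset_erase (A : Finset (Finset α)) (i : α) :
    ∀ u ∈ (A.filter fun x => i ∈ x).image compl, u ⊆ univ.erase i := by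
  intro u hu
  rw [mem_image] at hu
  obtain ⟨x, hx, rfl⟩ := hu
  intro a ha
  rw [mem_erase]
  refine ⟨?_, mem_univ a⟩
  rintro rfl
  exact (mem_compl.1 ha) (mem_filter.1 hx).2

/-- Level counts of the complemented `i ∈ x` section. [folklore] -/
theorem card_filter_image_compl (A : Finset (Finset α)) (i : α) (c : ℕ) :
    #(((A.filter fun x => i ∈ x).image compl).filter fun v => #v = c)
      = #(A.filter fun x => i ∈ x ∧ #xᶜ = c) := by
  rw [filter_image, card_image_of_injective _ compl_injective, filter_filter]

/-- Relative complements (inside `univ.erase i`) of the members avoiding `i` of an up-set form a lower set. [folklore] -/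
theorem isLowerSet_image_sdiff (A : Finset (Finset α)) (hA : IsUpperSet (A : Set (Finset α))) (i : α) :
    IsLowerSet (((A.filter fun x => i ∉ x).image fun x => univ.erase i \ x : Finset (Finset α)) : Set (Finset α)) := by
  intro v w hwv hv
  rw [mem_coe, mem_image] at hv ⊢
  obtain ⟨x, hx, rfl⟩ := hv
  rw [mem_filter] at hx
  -- `x ⊆ univ.erase i`
  have hxt : x ⊆ univ.erase i := by
    intro a ha; rw [mem_erase]; exact ⟨fun h => hx.2 (h ▸ ha), mem_univ a⟩
  refine ⟨univ.erase i \ w, mem_filter.2 ⟨?_, ?_⟩, ?_⟩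
  · -- `x ⊆ univ.erase i \ w`
    refine hA ?_ hx.1
    intro a ha
    rw [mem_sdiff]
    refine ⟨hxt ha, fun haw => ?_⟩
    have := hwv haw
    rw [mem_sdiff] at this
    exact this.2 ha
  · intro hi
    rw [mem_sdiff, mem_erase] at hi
    exact hi.1.1 rfl
  · -- `t \ (t \ w) = w` since `w ⊆ t`
    have hwt : w ⊆ univ.erase i := fun a ha => (mem_sdiff.1 (hwv ha)).1
    rw [sdiff_sdiff_right_self, inf_eq_inter, inter_eq_right.2 hwt]

/-- The members of the relatively complemented `i ∉ x` section avoid `i`. [folklore] -/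
theorem image_sdiff_subset_erase (A : Finset (Finset α)) (i : α) :
    ∀ u ∈ (A.filter fun x => i ∉ x).image (fun x => univ.erase i \ x), u ⊆ univ.erase i := by
  intro u hu
  rw [mem_image] at hu
  obtain ⟨x, _, rfl⟩ := hu
  exact sdiff_subset

/-- Level counts of the relatively complemented `i ∉ x` section. [folklore] -/
theorem card_filter_image_sdiff (A : Finset (Finset α)) (i : α) (c : ℕ) :
    #(((A.filter fun x => i ∉ x).image fun x => univ.erase i \ x).filter fun v => #v = c)
      = #(A.filter fun x => i ∉ x ∧ #(univ.erase i) - #x = c) := by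
  have hinj : Set.InjOn (fun x : Finset α => univ.erase i \ x) (A.filter fun x => i ∉ x) := by
    intro x hx y hy hxy
    have hxt : x ⊆ univ.erase i := by
      intro a ha; rw [mem_erase]; exact ⟨fun h => (mem_filter.1 hx).2 (h ▸ ha), mem_univ a⟩
    have hyt : y ⊆ univ.erase i := by
      intro a ha; rw [mem_erase]; exact ⟨fun h => (mem_filter.1 hy).2 (h ▸ ha), mem_univ a⟩
    have := congrArg (fun z => univ.erase i \ z) hxy
    simp only at this
    rwa [sdiff_sdiff_right_self, sdiff_sdiff_right_self, inf_eq_inter, inf_eq_inter, inter_eq_right.2 hxt,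
      inter_eq_right.2 hyt] at this
  rw [filter_image, card_image_of_injOn (fun x hx y hy h => hinj (mem_filter.1 hx).1 (mem_filter.1 hy).1 h), filter_filter]
  congr 1
  ext x
  simp only [mem_filter, and_congr_right_iff]
  intro _ hix
  have hxt : x ⊆ univ.erase i := by
    intro a ha; rw [mem_erase]; exact ⟨fun h => hix (h ▸ ha), mem_univ a⟩
  rw [card_sdiff_of_subset hxt]

/-! ### The mirror inequalities in the two sections -/

/-- Mirror inequality in the `i ∈ x` section of an up-set of `2m`-bit sets: `#{x ∈ A | i ∈ x, #x = b} ≤ #{x ∈ A | i ∈ x, #x = 2m+1−b}` for `1 ≤ b ≤ m`.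
[this work; local LYM] -/
theorem card_mem_level_le_mirror (m : ℕ) (hα : Fintype.card α = 2 * m) (A : Finset (Finset α))
    (hA : IsUpperSet (A : Set (Finset α))) (i : α) {b : ℕ} (hb1 : 1 ≤ b) (hbm : b ≤ m) :
    #(A.filter fun x => i ∈ x ∧ #x = b) ≤ #(A.filter fun x => i ∈ x ∧ #x = 2 * m + 1 - b) := by
  have ht : #(univ.erase i : Finset α) = 2 * m - 1 := by rw [card_erase_of_mem (mem_univ i), card_univ, hα]
  have key := card_level_mirror_le (univ.erase i) _ (isLowerSet_image_compl A hA i) (image_compl_subset_erase A i)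
    (i := b - 1) (by rw [ht]; omega)
  rw [ht, card_filter_image_compl, card_filter_image_compl] at key
  have h1 : (A.filter fun x => i ∈ x ∧ #xᶜ = 2 * m - 1 - (b - 1)) = A.filter fun x => i ∈ x ∧ #x = b := by
    refine filter_congr fun x _ => ?_
    rw [card_compl, hα]
    have : #x ≤ 2 * m := hα ▸ card_le_univ x
    constructor <;> rintro ⟨hi, h⟩ <;> exact ⟨hi, by omega⟩
  have h2 : (A.filter fun x => i ∈ x ∧ #xᶜ = b - 1) = A.filter fun x => i ∈ x ∧ #x = 2 * m + 1 - b := by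
    refine filter_congr fun x _ => ?_
    rw [card_compl, hα]
    have : #x ≤ 2 * m := hα ▸ card_le_univ x
    constructor <;> rintro ⟨hi, h⟩ <;> exact ⟨hi, by omega⟩
  rwa [h1, h2] at key

/-- Mirror inequality in the `i ∉ x` section of an up-set of `2m`-bit sets: `#{x ∈ A | i ∉ x, #x = b} ≤ #{x ∈ A | i ∉ x, #x = 2m−1−b}` for `b + 1 ≤ m`.
[this work; local LYM] -/
theorem card_not_mem_level_le_mirror (m : ℕ) (hα : Fintype.card α = 2 * m) (A : Finset (Finset α))
    (hA : IsUpperSet (A : Set (Finset α))) (i : α) {b : ℕ} (hbm : b + 1 ≤ m) :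
    #(A.filter fun x => i ∉ x ∧ #x = b) ≤ #(A.filter fun x => i ∉ x ∧ #x = 2 * m - 1 - b) := by
  have ht : #(univ.erase i : Finset α) = 2 * m - 1 := by rw [card_erase_of_mem (mem_univ i), card_univ, hα]
  have key := card_level_mirror_le (univ.erase i) _ (isLowerSet_image_sdiff A hA i) (image_sdiff_subset_erase A i)
    (i := b) (by rw [ht]; omega)
  rw [card_filter_image_sdiff, card_filter_image_sdiff, ht] at key
  have hxt : ∀ x : Finset α, i ∉ x → #x ≤ 2 * m - 1 := by
    intro x hix
    have hsub : x ⊆ univ.erase i := by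
      intro a ha; rw [mem_erase]; exact ⟨fun h => hix (h ▸ ha), mem_univ a⟩
    exact ht ▸ card_le_card hsub
  have h1 : (A.filter fun x => i ∉ x ∧ 2 * m - 1 - #x = 2 * m - 1 - b) = A.filter fun x => i ∉ x ∧ #x = b := by
    refine filter_congr fun x _ => ?_
    constructor
    · rintro ⟨hix, h⟩; exact ⟨hix, by have := hxt x hix; omega⟩
    · rintro ⟨hix, h⟩; exact ⟨hix, by omega⟩
  have h2 : (A.filter fun x => i ∉ x ∧ 2 * m - 1 - #x = b) = A.filter fun x => i ∉ x ∧ #x = 2 * m - 1 - b := by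
    refine filter_congr fun x _ => ?_
    constructor
    · rintro ⟨hix, h⟩; exact ⟨hix, by have := hxt x hix; omega⟩
    · rintro ⟨hix, h⟩; exact ⟨hix, by have := hxt x hix; omega⟩
  rwa [h1, h2] at key

/-! ### The vertical-bias lemma -/

/-- **Vertical-bias lemma.**  For an up-set `A` of subsets of a `2m`-set and any point `i`:
`#{x ∈ A | #x < m} + #{x ∈ A | #x = m ∧ i ∈ x} ≤ #{x ∈ A | m < #x} + #{x ∈ A | #x = m ∧ i ∉ x}`,
i.e. the vertical imbalance `#A_{>m} − #A_{<m}` dominates the bias `#{y ∈ A_m : i ∈ y} − #{y ∈ A_m : i ∉ y}` of the middle layer towards `i`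
(equality for the dictator `A = {x | i ∈ x}`).  Equivalent to the sharp single-level Harris inequality `Cov(1_A, g) ≥ 2·P(#x = m)·Cov(1_A, g | #x = m)`
for the extremal `g = 1{#x > m ∨ (#x = m ∧ i ∈ x)}` (memo FINDING-SLACK-INDUCTION-g30 §0(5)). [this work] -/
theorem card_lt_add_card_mid_mem_le (m : ℕ) (hα : Fintype.card α = 2 * m) (A : Finset (Finset α))
    (hA : IsUpperSet (A : Set (Finset α))) (i : α) :
    #(A.filter fun x => #x < m) + #(A.filter fun x => #x = m ∧ i ∈ x)
      ≤ #(A.filter fun x => m < #x) + #(A.filter fun x => #x = m ∧ i ∉ x) := by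
  have hm : 1 ≤ m := by have := Fintype.card_pos_iff.2 ⟨i⟩; omega
  have hxle : ∀ x : Finset α, #x ≤ 2 * m := fun x => hα ▸ card_le_univ x
  have hxt : ∀ x : Finset α, i ∉ x → #x ≤ 2 * m - 1 := by
    intro x hix
    have hsub : x ⊆ univ.erase i := by
      intro a ha; rw [mem_erase]; exact ⟨fun h => hix (h ▸ ha), mem_univ a⟩
    have := card_le_card hsub
    rw [card_erase_of_mem (mem_univ i), card_univ, hα] at this
    exact this
  -- regroup the left side by the two sections
  have hL : #(A.filter fun x => #x < m) + #(A.filter fun x => #x = m ∧ i ∈ x)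
      = #(A.filter fun x => i ∈ x ∧ #x ≤ m) + #(A.filter fun x => i ∉ x ∧ #x < m) := by
    have e1 : #(A.filter fun x => #x < m) = #(A.filter fun x => i ∈ x ∧ #x < m) + #(A.filter fun x => i ∉ x ∧ #x < m) := by
      rw [← card_filter_add_card_filter_not (s := A.filter fun x => #x < m) (fun x => i ∈ x), filter_filter, filter_filter]
      congr 1 <;> exact congrArg card (filter_congr fun x _ => by tauto)
    have e2 : #(A.filter fun x => i ∈ x ∧ #x ≤ m) = #(A.filter fun x => i ∈ x ∧ #x < m) + #(A.filter fun x => #x = m ∧ i ∈ x) := by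
      rw [← card_filter_add_card_filter_not (s := A.filter fun x => i ∈ x ∧ #x ≤ m) (fun x => #x < m), filter_filter, filter_filter]
      congr 1 <;> refine congrArg card (filter_congr fun x _ => ?_) <;> constructor
      · rintro ⟨⟨h1, _⟩, h3⟩; exact ⟨h1, h3⟩
      · rintro ⟨h1, h3⟩; exact ⟨⟨h1, h3.le⟩, h3⟩
      · rintro ⟨⟨h1, h2⟩, h3⟩; exact ⟨by omega, h1⟩
      · rintro ⟨h1, h3⟩; exact ⟨⟨h3, h1.le⟩, by omega⟩
    omega
  -- regroup the right side by the two sections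
  have hR : #(A.filter fun x => m < #x) + #(A.filter fun x => #x = m ∧ i ∉ x)
      = #(A.filter fun x => i ∈ x ∧ m < #x) + #(A.filter fun x => i ∉ x ∧ m ≤ #x) := by
    have e1 : #(A.filter fun x => m < #x) = #(A.filter fun x => i ∈ x ∧ m < #x) + #(A.filter fun x => i ∉ x ∧ m < #x) := by
      rw [← card_filter_add_card_filter_not (s := A.filter fun x => m < #x) (fun x => i ∈ x), filter_filter, filter_filter]
      congr 1 <;> exact congrArg card (filter_congr fun x _ => by tauto)
    have e2 : #(A.filter fun x => i ∉ x ∧ m ≤ #x) = #(A.filter fun x => i ∉ x ∧ m < #x) + #(A.filter fun x => #x = m ∧ i ∉ x) := by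
      rw [← card_filter_add_card_filter_not (s := A.filter fun x => i ∉ x ∧ m ≤ #x) (fun x => m < #x), filter_filter, filter_filter]
      congr 1 <;> refine congrArg card (filter_congr fun x _ => ?_) <;> constructor
      · rintro ⟨⟨h1, _⟩, h3⟩; exact ⟨h1, h3⟩
      · rintro ⟨h1, h3⟩; exact ⟨⟨h1, h3.le⟩, h3⟩
      · rintro ⟨⟨h1, h2⟩, h3⟩; exact ⟨by omega, h1⟩
      · rintro ⟨h1, h3⟩; exact ⟨⟨h3, h1.ge⟩, by omega⟩
    omega
  rw [hL, hR]
  -- fibrewise comparison, `i ∈ x` section: index `b = #x ∈ [1, m]` on the left, `#x = 2m+1-b` on the right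
  have hP : #(A.filter fun x => i ∈ x ∧ #x ≤ m) ≤ #(A.filter fun x => i ∈ x ∧ m < #x) := by
    have hmap1 : Set.MapsTo (fun x : Finset α => #x) (A.filter fun x => i ∈ x ∧ #x ≤ m : Finset (Finset α)) (Icc 1 m : Finset ℕ) := by
      intro x hx
      rw [mem_coe, mem_filter] at hx
      rw [mem_coe, mem_Icc]
      exact ⟨card_pos.2 ⟨i, hx.2.1⟩, hx.2.2⟩
    have hmap2 : Set.MapsTo (fun x : Finset α => 2 * m + 1 - #x) (A.filter fun x => i ∈ x ∧ m < #x : Finset (Finset α))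
        (Icc 1 m : Finset ℕ) := by
      intro x hx
      rw [mem_coe, mem_filter] at hx
      simp only [mem_coe, mem_Icc]
      have := hxle x
      constructor <;> omega
    rw [card_eq_sum_card_fiberwise hmap1, card_eq_sum_card_fiberwise hmap2]
    refine sum_le_sum fun b hb => ?_
    rw [mem_Icc] at hb
    rw [filter_filter, filter_filter]
    calc #(A.filter fun x => (i ∈ x ∧ #x ≤ m) ∧ #x = b)
        = #(A.filter fun x => i ∈ x ∧ #x = b) := congrArg card (filter_congr fun x _ => by
            constructor
            · rintro ⟨⟨h1, _⟩, h3⟩; exact ⟨h1, h3⟩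
            · rintro ⟨h1, h3⟩; exact ⟨⟨h1, by omega⟩, h3⟩)
      _ ≤ #(A.filter fun x => i ∈ x ∧ #x = 2 * m + 1 - b) := card_mem_level_le_mirror m hα A hA i hb.1 hb.2
      _ = #(A.filter fun x => (i ∈ x ∧ m < #x) ∧ 2 * m + 1 - #x = b) := congrArg card (filter_congr fun x _ => by
            have := hxle x
            constructor
            · rintro ⟨h1, h3⟩; exact ⟨⟨h1, by omega⟩, by omega⟩
            · rintro ⟨⟨h1, _⟩, h3⟩; exact ⟨h1, by omega⟩)
  -- fibrewise comparison, `i ∉ x` section: index `b = #x ∈ [0, m-1]` on the left, `#x = 2m-1-b` on the right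
  have hN : #(A.filter fun x => i ∉ x ∧ #x < m) ≤ #(A.filter fun x => i ∉ x ∧ m ≤ #x) := by
    have hmap1 : Set.MapsTo (fun x : Finset α => #x) (A.filter fun x => i ∉ x ∧ #x < m : Finset (Finset α)) (range m : Finset ℕ) := by
      intro x hx
      rw [mem_coe, mem_filter] at hx
      rw [mem_coe, mem_range]
      exact hx.2.2
    have hmap2 : Set.MapsTo (fun x : Finset α => 2 * m - 1 - #x) (A.filter fun x => i ∉ x ∧ m ≤ #x : Finset (Finset α))
        (range m : Finset ℕ) := by
      intro x hx
      rw [mem_coe, mem_filter] at hx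
      simp only [mem_coe, mem_range]
      have := hxt x hx.2.1
      omega
    rw [card_eq_sum_card_fiberwise hmap1, card_eq_sum_card_fiberwise hmap2]
    refine sum_le_sum fun b hb => ?_
    rw [mem_range] at hb
    rw [filter_filter, filter_filter]
    calc #(A.filter fun x => (i ∉ x ∧ #x < m) ∧ #x = b)
        = #(A.filter fun x => i ∉ x ∧ #x = b) := congrArg card (filter_congr fun x _ => by
            constructor
            · rintro ⟨⟨h1, _⟩, h3⟩; exact ⟨h1, h3⟩
            · rintro ⟨h1, h3⟩; exact ⟨⟨h1, by omega⟩, h3⟩)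
      _ ≤ #(A.filter fun x => i ∉ x ∧ #x = 2 * m - 1 - b) := card_not_mem_level_le_mirror m hα A hA i (by omega)
      _ = #(A.filter fun x => (i ∉ x ∧ m ≤ #x) ∧ 2 * m - 1 - #x = b) := congrArg card (filter_congr fun x _ => by
            constructor
            · rintro ⟨h1, h3⟩; exact ⟨⟨h1, by omega⟩, by omega⟩
            · rintro ⟨⟨h1, _⟩, h3⟩; exact ⟨h1, by have := hxt x h1; omega⟩)
  exact Nat.add_le_add hP hN

/-! ### The single-coordinate lemma -/

/-- **Single-coordinate lemma** (sharp).  For an up-set `A` of subsets of a `2m`-set, `1 ≤ m`, and a point `i`, the number of pivotal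
`i`-edges `#{x | i ∉ x, x ∉ A, insert i x ∈ A}` is at least twice the middle-layer bias:
`2·#{y ∈ A | #y = m ∧ i ∈ y} ≤ 2·#{y ∈ A | #y = m ∧ i ∉ y} + #{x | i ∉ x ∧ x ∉ A ∧ insert i x ∈ A}`.
(Probabilistic form: `I_i(1_A) ≥ 2·P(#x = m)·d_i(1_A)`, the dictator case `f = x_i` of `Cov(f,g) ≥ 2·P(#x=m)·Cov(f,g | #x=m)`; equality for
`A = {x | m < #x ∨ (#x = m ∧ i ∈ x)}`; memo g29 §0(9), g30 §0(3).)  Proof: the pivotal edges between levels `m−1, m` and between `m, m+1`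
number `(P_m − N_{m−1}) + (P_{m+1} − N_m)` with `P_ℓ = #{y ∈ A_ℓ | i ∈ y}`, `N_ℓ = #{y ∈ A_ℓ | i ∉ y}`, and `P_m ≤ P_{m+1}`, `N_{m−1} ≤ N_m` are the
mirror inequalities at the middle pair of levels of the odd sections. [this work] -/
theorem two_mul_card_mid_mem_le (m : ℕ) (hm : 1 ≤ m) (hα : Fintype.card α = 2 * m) (A : Finset (Finset α))
    (hA : IsUpperSet (A : Set (Finset α))) (i : α) :
    2 * #(A.filter fun y => #y = m ∧ i ∈ y)
      ≤ 2 * #(A.filter fun y => #y = m ∧ i ∉ y)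
        + #((univ : Finset (Finset α)).filter fun x => i ∉ x ∧ x ∉ A ∧ insert i x ∈ A) := by
  -- notation-free counts
  set P : ℕ → ℕ := fun l => #(A.filter fun y => i ∈ y ∧ #y = l) with hPdef
  set N : ℕ → ℕ := fun l => #(A.filter fun y => i ∉ y ∧ #y = l) with hNdef
  have hPm : #(A.filter fun y => #y = m ∧ i ∈ y) = P m := congrArg card (filter_congr fun x _ => by tauto)
  have hNm : #(A.filter fun y => #y = m ∧ i ∉ y) = N m := congrArg card (filter_congr fun x _ => by tauto)
  -- mirror at the middle pair: `P m ≤ P (m+1)` and `N (m-1) ≤ N m`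
  have hPP : P m ≤ P (m + 1) := by
    have := card_mem_level_le_mirror m hα A hA i (b := m) hm le_rfl
    rwa [show 2 * m + 1 - m = m + 1 by omega] at this
  have hNN : N (m - 1) ≤ N m := by
    have := card_not_mem_level_le_mirror m hα A hA i (b := m - 1) (by omega)
    rwa [show 2 * m - 1 - (m - 1) = m by omega] at this
  -- pivotal edges from level `l` to `l+1`: at least `P (l+1) - N l`, via the injection `x ↦ insert i x`
  have hpiv : ∀ l : ℕ, P (l + 1) ≤ N l + #((univ : Finset (Finset α)).filter fun x => (i ∉ x ∧ x ∉ A ∧ insert i x ∈ A) ∧ #x = l) := by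
    intro l
    -- `P (l+1)` counts `{y ∈ A | i ∈ y, #y = l+1}`; the map `y ↦ y.erase i` injects it into
    -- `{x | i ∉ x, #x = l, insert i x ∈ A}` = (those in `A`, counted by `N l`) ⊔ (those not in `A`, pivotal)
    have hinj : Set.InjOn (fun y : Finset α => y.erase i) (A.filter fun y => i ∈ y ∧ #y = l + 1) := by
      intro y hy y' hy' h
      have hyi := (mem_filter.1 hy).2.1
      have hy'i := (mem_filter.1 hy').2.1
      simp only at h
      rw [← insert_erase hyi, ← insert_erase hy'i, h]
    have himg : (A.filter fun y => i ∈ y ∧ #y = l + 1).image (fun y => y.erase i)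
        ⊆ (A.filter fun x => i ∉ x ∧ #x = l) ∪
          ((univ : Finset (Finset α)).filter fun x => (i ∉ x ∧ x ∉ A ∧ insert i x ∈ A) ∧ #x = l) := by
      intro x hx
      rw [mem_image] at hx
      obtain ⟨y, hy, rfl⟩ := hx
      rw [mem_filter] at hy
      obtain ⟨hyA, hyi, hyl⟩ := hy
      have hcard : #(y.erase i) = l := by rw [card_erase_of_mem hyi, hyl]; rfl
      have hins : insert i (y.erase i) ∈ A := by rw [insert_erase hyi]; exact hyA
      by_cases hxA : y.erase i ∈ A
      · exact mem_union_left _ (mem_filter.2 ⟨hxA, notMem_erase i y, hcard⟩)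
      · exact mem_union_right _ (mem_filter.2 ⟨mem_univ _, ⟨notMem_erase i y, hxA, hins⟩, hcard⟩)
    calc P (l + 1) = #((A.filter fun y => i ∈ y ∧ #y = l + 1).image fun y => y.erase i) := (card_image_of_injOn hinj).symm
      _ ≤ #((A.filter fun x => i ∉ x ∧ #x = l) ∪
          ((univ : Finset (Finset α)).filter fun x => (i ∉ x ∧ x ∉ A ∧ insert i x ∈ A) ∧ #x = l)) := card_le_card himg
      _ ≤ N l + #((univ : Finset (Finset α)).filter fun x => (i ∉ x ∧ x ∉ A ∧ insert i x ∈ A) ∧ #x = l) := card_union_le _ _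
  -- the two pivotal layers are disjoint parts of the pivotal set
  have hsum : #((univ : Finset (Finset α)).filter fun x => (i ∉ x ∧ x ∉ A ∧ insert i x ∈ A) ∧ #x = m - 1)
      + #((univ : Finset (Finset α)).filter fun x => (i ∉ x ∧ x ∉ A ∧ insert i x ∈ A) ∧ #x = m)
      ≤ #((univ : Finset (Finset α)).filter fun x => i ∉ x ∧ x ∉ A ∧ insert i x ∈ A) := by
    have hdisj : Disjoint ((univ : Finset (Finset α)).filter fun x => (i ∉ x ∧ x ∉ A ∧ insert i x ∈ A) ∧ #x = m - 1)
        ((univ : Finset (Finset α)).filter fun x => (i ∉ x ∧ x ∉ A ∧ insert i x ∈ A) ∧ #x = m) := by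
      rw [disjoint_filter]
      intro x _ h1 h2
      omega
    rw [← card_union_of_disjoint hdisj]
    refine card_le_card (union_subset ?_ ?_) <;>
      · intro x hx
        rw [mem_filter] at hx ⊢
        exact ⟨hx.1, hx.2.1⟩
  have h1 := hpiv (m - 1)
  rw [show m - 1 + 1 = m by omega] at h1
  have h2 := hpiv m
  rw [hPm, hNm]
  omega

end Summit.CriticalPhenomena.PercolationContinuityZ3.Theorems.AntiBandVerticalBias
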